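import Literature.Dynamics.Hyperbolic.ChowLinPalmerShadowing
import Mathlib.Analysis.Calculus.FDeriv.Comp

/-!
# Calculus of a Chow–Lin–Palmer hyperbolic structure: restriction, splitting algebra, transport along iterates

Topic `Literature/Dynamics/Hyperbolic`.  Elementary consequences of the hypothesis structure
`IsCLPHyperbolicSet ψ T P Q N λ Δ` (`Literature/Dynamics/Hyperbolic/ChowLinPalmerShadowing.lean`, Pilyugin1999
§1.3.4 (1.86)–(1.88)) used by the tracking theorem (`HyperbolicTracking.lean`) and by any other dichotomy
estimate along orbits in `T`:

* `IsCLPHyperbolicSet.mono` — restriction to a positively invariant subset (e.g. `{p₀} ⊆ {p₀} ∪ {q_n}`);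
* the projector algebra on `T` (`P x + Q x = id`, `P`/`Q` idempotent and mutually annihilating on ranges);
* transport along iterates: the chain rule `D(ψ^{a+b})(x) = D(ψ^a)(ψ^b x) ∘ D(ψ^b)(x)`, invariance of the
  stable ranges and bijectivity on the unstable ranges under `D(ψ^m)(x)`, the stable `m`-step bound
  `‖D(ψ^m)(x) P(x) v‖ ≤ Nλ^m‖v‖` for ALL `m ≥ 0`, and the unstable `m`-step SOLVE (the unique preimage in `U(x)`
  of `Q(ψ^m x) v` under `D(ψ^m)(x)` has norm `≤ Nλ^m ‖v‖`) — no inverse operators are ever formed.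

All statements are folklore linear algebra / calculus; no invertibility of `ψ` or `Dψ` is used.
References: S. Yu. Pilyugin, *Shadowing in Dynamical Systems*, LNM 1706 (1999), §1.3.4 [Pilyugin1999].
-/

noncomputable section

open Set Function Metric
open scoped Topology

namespace Literature.Dynamics.Hyperbolic

variable {E : Type*} [NormedAddCommGroup E] [NormedSpace ℝ E]

/-! ## Restriction of a Chow–Lin–Palmer structure to a positively invariant subset -/

/-- A Chow–Lin–Palmer hyperbolic structure restricts to every positively invariant subset (same projectors and
constants); e.g. to the fixed point `{p₀}` of a homoclinic loop `{p₀} ∪ {q_n}`. [folklore] -/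
theorem IsCLPHyperbolicSet.mono {ψ : E → E} {T T' : Set E} {P Q : E → E →L[ℝ] E} {N lam Δ : ℝ}
    (h : IsCLPHyperbolicSet ψ T P Q N lam Δ) (hT' : T' ⊆ T) (hmaps : MapsTo ψ T' T') :
    IsCLPHyperbolicSet ψ T' P Q N lam Δ where
  contDiff := h.contDiff
  mapsTo := hmaps
  add_eq x hx := h.add_eq x (hT' hx)
  isIdempotentElem x hx := h.isIdempotentElem x (hT' hx)
  continuousOn_P := h.continuousOn_P.mono hT'
  continuousOn_Q := h.continuousOn_Q.mono hT'
  mapsTo_stable x hx := h.mapsTo_stable x (hT' hx)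
  bijOn_unstable x hx := h.bijOn_unstable x (hT' hx)
  antilipschitz_unstable x hx := h.antilipschitz_unstable x (hT' hx)
  N_pos := h.N_pos
  lam_pos := h.lam_pos
  lam_lt_one := h.lam_lt_one
  norm_P_le x hx := h.norm_P_le x (hT' hx)
  norm_Q_le x hx := h.norm_Q_le x (hT' hx)
  norm_fderiv_iterate_comp_P_le x hx := h.norm_fderiv_iterate_comp_P_le x (hT' hx)
  norm_le_of_fderiv_iterate_eq x hx := h.norm_le_of_fderiv_iterate_eq x (hT' hx)
  Δ_pos := h.Δ_pos
  bounded := by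
    obtain ⟨M, hM⟩ := h.bounded
    exact ⟨M, fun y hy => hM y (cthickening_subset_of_subset Δ hT' hy)⟩
  uniformContinuousOn := h.uniformContinuousOn.mono (cthickening_subset_of_subset Δ hT')
  uniformContinuousOn_fderiv := h.uniformContinuousOn_fderiv.mono (cthickening_subset_of_subset Δ hT')

/-! ## Algebra of the splitting along a CLP set -/

section Algebra

variable {ψ : E → E} {T : Set E} {P Q : E → E →L[ℝ] E} {N lam Δ : ℝ}

/-- `P x + Q x = id` on `T`, applied. [folklore] -/
theorem IsCLPHyperbolicSet.P_add_Q_apply (h : IsCLPHyperbolicSet ψ T P Q N lam Δ) {x : E} (hx : x ∈ T)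
    (v : E) : P x v + Q x v = v := by
  have := congrArg (fun f : E →L[ℝ] E => f v) (h.add_eq x hx)
  simpa using this

/-- `P x` is the identity on its range. [folklore] -/
theorem IsCLPHyperbolicSet.P_apply_of_mem (h : IsCLPHyperbolicSet ψ T P Q N lam Δ) {x : E} (hx : x ∈ T)
    {w : E} (hw : w ∈ range (P x)) : P x w = w := by
  obtain ⟨v, rfl⟩ := hw
  have := congrArg (fun f : E →L[ℝ] E => f v) (h.isIdempotentElem x hx)
  simpa using this

/-- `P x` kills the range of `Q x`. [folklore] -/
theorem IsCLPHyperbolicSet.P_apply_of_mem_Q (h : IsCLPHyperbolicSet ψ T P Q N lam Δ) {x : E} (hx : x ∈ T)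
    {w : E} (hw : w ∈ range (Q x)) : P x w = 0 := by
  obtain ⟨v, rfl⟩ := hw
  have hQ : Q x v = v - P x v := eq_sub_of_add_eq' (h.P_add_Q_apply hx v)
  rw [hQ, map_sub, h.P_apply_of_mem hx (mem_range_self v), sub_self]

/-- `Q x` is the identity on its range. [folklore] -/
theorem IsCLPHyperbolicSet.Q_apply_of_mem_Q (h : IsCLPHyperbolicSet ψ T P Q N lam Δ) {x : E} (hx : x ∈ T)
    {w : E} (hw : w ∈ range (Q x)) : Q x w = w := by
  have h1 := h.P_add_Q_apply hx w
  rw [h.P_apply_of_mem_Q hx hw, zero_add] at h1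
  exact h1

/-- `Q x` kills the range of `P x`. [folklore] -/
theorem IsCLPHyperbolicSet.Q_apply_of_mem_P (h : IsCLPHyperbolicSet ψ T P Q N lam Δ) {x : E} (hx : x ∈ T)
    {w : E} (hw : w ∈ range (P x)) : Q x w = 0 := by
  have h1 := h.P_add_Q_apply hx w
  rw [h.P_apply_of_mem hx hw] at h1
  simpa using h1

/-- The range of a continuous linear map is closed under subtraction. [folklore] -/
theorem sub_mem_range_clm (L : E →L[ℝ] E) {a b : E} (ha : a ∈ range L) (hb : b ∈ range L) :
    a - b ∈ range L := by
  obtain ⟨u, rfl⟩ := ha; obtain ⟨v, rfl⟩ := hb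
  exact ⟨u - v, map_sub L u v⟩

/-- The range of a continuous linear map is closed under finite sums. [folklore] -/
theorem sum_mem_range_clm (L : E →L[ℝ] E) {ι : Type*} (s : Finset ι) (f : ι → E)
    (hf : ∀ i ∈ s, f i ∈ range L) : ∑ i ∈ s, f i ∈ range L := by
  classical
  induction s using Finset.induction_on with
  | empty => exact ⟨0, by simp⟩
  | insert a s has ih =>
    rw [Finset.sum_insert has]
    obtain ⟨u, hu⟩ := hf a (Finset.mem_insert_self a s)
    obtain ⟨v, hv⟩ := ih fun i hi => hf i (Finset.mem_insert_of_mem hi)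
    exact ⟨u + v, by rw [map_add, hu, hv]⟩

/-! ### Iterates along an orbit in `T` -/

omit [NormedAddCommGroup E] [NormedSpace ℝ E] in
/-- Along a finite orbit segment, `ψ^[m] (y j) = y (j + m)`. [folklore] -/
theorem iterate_orbit {y : ℕ → E} {n : ℕ} (hy : ∀ i, i < n → ψ (y i) = y (i + 1)) {j m : ℕ}
    (hjm : j + m ≤ n) : ψ^[m] (y j) = y (j + m) := by
  induction m with
  | zero => simp
  | succ m ih =>
    rw [Function.iterate_succ_apply', ih (by omega), hy (j + m) (by omega)]
    rfl

/-- `T` is invariant under all iterates. [folklore] -/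
theorem IsCLPHyperbolicSet.iterate_mem (h : IsCLPHyperbolicSet ψ T P Q N lam Δ) {x : E} (hx : x ∈ T)
    (m : ℕ) : ψ^[m] x ∈ T :=
  (h.mapsTo.iterate m) hx

/-- Iterates of a `C¹` map are differentiable. [folklore] -/
theorem IsCLPHyperbolicSet.differentiable_iterate (h : IsCLPHyperbolicSet ψ T P Q N lam Δ) (m : ℕ) :
    Differentiable ℝ (ψ^[m]) :=
  (h.contDiff.differentiable one_ne_zero).iterate m

/-- CHAIN RULE FOR ITERATES: `D(ψ^{a+b})(x) = D(ψ^a)(ψ^b x) ∘ D(ψ^b)(x)`. [folklore] -/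
theorem IsCLPHyperbolicSet.fderiv_iterate_add (h : IsCLPHyperbolicSet ψ T P Q N lam Δ) (a b : ℕ) (x : E) :
    fderiv ℝ (ψ^[a + b]) x = (fderiv ℝ (ψ^[a]) (ψ^[b] x)).comp (fderiv ℝ (ψ^[b]) x) := by
  rw [Function.iterate_add]
  exact fderiv_comp x ((h.differentiable_iterate a) _) ((h.differentiable_iterate b) x)

/-- One more step on the left: `D(ψ^{m+1})(x) = Dψ(ψ^m x) ∘ D(ψ^m)(x)`. [folklore] -/
theorem IsCLPHyperbolicSet.fderiv_iterate_succ (h : IsCLPHyperbolicSet ψ T P Q N lam Δ) (m : ℕ) (x : E) :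
    fderiv ℝ (ψ^[m + 1]) x = (fderiv ℝ ψ (ψ^[m] x)).comp (fderiv ℝ (ψ^[m]) x) := by
  have := h.fderiv_iterate_add 1 m x
  simpa only [Nat.add_comm 1 m, Function.iterate_one] using this

/-- STABLE TRANSPORT: `D(ψ^m)(x)` maps `S(x) = range (P x)` into `S(ψ^m x)`. [folklore] -/
theorem IsCLPHyperbolicSet.mapsTo_stable_iterate (h : IsCLPHyperbolicSet ψ T P Q N lam Δ) {x : E}
    (hx : x ∈ T) : ∀ m : ℕ, MapsTo (fderiv ℝ (ψ^[m]) x) (range (P x)) (range (P (ψ^[m] x)))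
  | 0 => by
    intro w hw
    simpa only [Function.iterate_zero, fderiv_id, ContinuousLinearMap.coe_id', id_eq] using hw
  | m + 1 => by
    intro w hw
    rw [h.fderiv_iterate_succ m x, ContinuousLinearMap.coe_comp, Function.comp_apply,
      Function.iterate_succ_apply']
    exact h.mapsTo_stable _ (h.iterate_mem hx m) (h.mapsTo_stable_iterate hx m hw)

/-- UNSTABLE TRANSPORT: `D(ψ^m)(x) : U(x) → U(ψ^m x)` is a bijection. [folklore] -/
theorem IsCLPHyperbolicSet.bijOn_unstable_iterate (h : IsCLPHyperbolicSet ψ T P Q N lam Δ) {x : E}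
    (hx : x ∈ T) : ∀ m : ℕ, BijOn (fderiv ℝ (ψ^[m]) x) (range (Q x)) (range (Q (ψ^[m] x)))
  | 0 => by
    simp only [Function.iterate_zero, fderiv_id, ContinuousLinearMap.coe_id', id_eq]
    exact bijOn_id _
  | m + 1 => by
    rw [h.fderiv_iterate_succ m x, ContinuousLinearMap.coe_comp, Function.iterate_succ_apply']
    exact (h.bijOn_unstable _ (h.iterate_mem hx m)).comp (h.bijOn_unstable_iterate hx m)

/-- STABLE `m`-STEP BOUND (all `m ≥ 0`): `‖D(ψ^m)(x) P(x) v‖ ≤ N λ^m ‖v‖`. [folklore] -/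
theorem IsCLPHyperbolicSet.norm_fderiv_iterate_P_le (h : IsCLPHyperbolicSet ψ T P Q N lam Δ) {x : E}
    (hx : x ∈ T) (m : ℕ) (v : E) : ‖fderiv ℝ (ψ^[m]) x (P x v)‖ ≤ N * lam ^ m * ‖v‖ := by
  rcases Nat.eq_zero_or_pos m with rfl | hm
  · simp only [Function.iterate_zero, fderiv_id, ContinuousLinearMap.coe_id', id_eq, pow_zero, mul_one]
    exact (ContinuousLinearMap.le_opNorm _ _).trans
      (mul_le_mul_of_nonneg_right (h.norm_P_le x hx) (norm_nonneg _))
  · have hb := h.norm_fderiv_iterate_comp_P_le x hx m hm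
    calc ‖fderiv ℝ (ψ^[m]) x (P x v)‖ = ‖((fderiv ℝ (ψ^[m]) x).comp (P x)) v‖ := rfl
      _ ≤ ‖(fderiv ℝ (ψ^[m]) x).comp (P x)‖ * ‖v‖ := ContinuousLinearMap.le_opNorm _ _
      _ ≤ N * lam ^ m * ‖v‖ := mul_le_mul_of_nonneg_right hb (norm_nonneg _)

/-- UNSTABLE `m`-STEP SOLVE (all `m ≥ 0`): for every `v` there is `u ∈ U(x)` with `D(ψ^m)(x) u = Q(ψ^m x) v`
and `‖u‖ ≤ N λ^m ‖v‖`. [folklore] -/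
theorem IsCLPHyperbolicSet.exists_unstable_solve (h : IsCLPHyperbolicSet ψ T P Q N lam Δ) {x : E}
    (hx : x ∈ T) (m : ℕ) (v : E) :
    ∃ u ∈ range (Q x), fderiv ℝ (ψ^[m]) x u = Q (ψ^[m] x) v ∧ ‖u‖ ≤ N * lam ^ m * ‖v‖ := by
  rcases Nat.eq_zero_or_pos m with rfl | hm
  · refine ⟨Q x v, mem_range_self v, ?_, ?_⟩
    · simp only [Function.iterate_zero, fderiv_id, ContinuousLinearMap.coe_id', id_eq]
    · simp only [pow_zero, mul_one]
      exact (ContinuousLinearMap.le_opNorm _ _).trans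
        (mul_le_mul_of_nonneg_right (h.norm_Q_le x hx) (norm_nonneg _))
  · obtain ⟨u, hu, heq⟩ :=
      (h.bijOn_unstable_iterate hx m).surjOn (mem_range_self (f := Q (ψ^[m] x)) v)
    exact ⟨u, hu, heq, h.norm_le_of_fderiv_iterate_eq x hx m hm v u hu heq⟩

end Algebra

end Literature.Dynamics.Hyperbolic

end
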